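import Literature.Analysis.Calculus.RealAnalyticZeroSetProofs
import Mathlib.Analysis.InnerProductSpace.PiL2
import Mathlib.MeasureTheory.Measure.Haar.Unique
import HarnessLib

/-!
# The zero set of a non-trivial real-analytic function is null for EVERY additive Haar measure on EVERY
# finite-dimensional real normed space ([Mityagin2015] Proposition 1, coordinate-free form; `ℝ`- and `ℂ`-valued)

Topic `Literature/Analysis/Calculus`.  [Mityagin2015] B. S. Mityagin, *The zero set of a real analytic function*,
Math. Notes **107** (2020) 529–530 / arXiv:1512.07276, **Proposition 1**: *«Let A(x) be a real analytic function on a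
connected open domain U of ℝ^d. If A is not identically zero, then its zero set F(A) = {x ∈ U : A(x) = 0} has zero
measure, mes_d F(A) = 0.»*  The tree PROVES this on `EuclideanSpace ℝ (Fin d)` with Lebesgue measure `volume`
(`Literature.Analysis.Calculus.realAnalytic_zeroSet_null_holds`, file `RealAnalyticZeroSetProofs`).  Consumers
(`Literature/LinearAlgebra/Matrix/CharpolyDiscriminantNull`, and the Haar-measure files of
`Literature/MathematicalPhysics/QuantumFieldTheory/Balaban1983to89`) need it on an arbitrary finite-dimensional real
vector space `E` (a Lie algebra `𝔤 ⊆ M_N(ℂ)`) with an arbitrary additive Haar measure `η` and for `ℂ`-valued analytic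
functions; this file performs that transport ONCE: linear coordinates `ψ : ℝ^d ≃L[ℝ] E`
(`ContinuousLinearEquiv.ofFinrankEq`), `η = c • ψ_* vol` (uniqueness of Haar measure, Mathlib
`Measure.isAddLeftInvariant_eq_smul`), and for `ℂ`-valued `f` the real-analytic `|f|² = (Re f)² + (Im f)²` with the same
zero set.

WHAT IS PROVED (theorems only; 0 definitions, 0 named facts, 0 sorry).
* `addHaar_zeroSet_eq_zero_of_analyticOnNhd` — `E` a finite-dimensional real normed space, `η` an additive Haar measure
  on `E`, `U ⊆ E` open and connected, `f : E → ℝ` real-analytic on `U` and `f x ≠ 0` for some `x ∈ U` ⟹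
  `η {x ∈ U | f x = 0} = 0`; `addHaar_zeroSet_eq_zero_of_analyticOnNhd_univ` (`U = E`).
* `addHaar_zeroSet_eq_zero_of_analyticOnNhd_complex`, `…_complex_univ` — the same for `f : E → ℂ` real-analytic
  (`AnalyticOnNhd ℝ`).
* `ae_ne_zero_of_analyticOnNhd_univ`, `ae_ne_zero_of_analyticOnNhd_complex_univ` — almost-everywhere forms.

HONEST SCOPE.  Pure transport of the tree's theorem; connectedness of `U` is kept as printed (it is needed: on a
disconnected `U` a function may vanish on one component).  Nothing of `RealAnalyticZeroSetProofs` is re-proved.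

## References
* B. S. Mityagin, *The zero set of a real analytic function*, Math. Notes **107** (2020) 529–530; arXiv:1512.07276,
  Proposition 1. [Mityagin2015]
-/

noncomputable section

open Set Function MeasureTheory
open _root_.Topology _root_.Complex

namespace Literature.Analysis.Calculus

variable {E : Type*} [NormedAddCommGroup E] [NormedSpace ℝ E] [FiniteDimensional ℝ E]
  [MeasurableSpace E] [BorelSpace E] (η : Measure E) [η.IsAddHaarMeasure]

/-- **[Mityagin2015] Prop. 1 for every additive Haar measure on every finite-dimensional real normed space**: if
`f : E → ℝ` is real-analytic on the connected open set `U` and not identically zero there, then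
`η {x ∈ U | f x = 0} = 0`.  (Coordinates `ψ : ℝ^d ≃L[ℝ] E`, the tree's `realAnalytic_zeroSet_null_holds` for `f ∘ ψ` on
`ψ⁻¹(U)`, and `η = c • ψ_* vol`.) [cite: Mityagin2015, Proposition 1] -/
theorem addHaar_zeroSet_eq_zero_of_analyticOnNhd {U : Set E} (hU : IsOpen U) (hUc : IsConnected U) {f : E → ℝ}
    (hf : AnalyticOnNhd ℝ f U) (hne : ∃ x ∈ U, f x ≠ 0) : η {x ∈ U | f x = 0} = 0 := by
  classical
  -- coordinates `ψ : ℝ^d ≃ E`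
  set d := Module.finrank ℝ E with hd
  have hfin : Module.finrank ℝ (EuclideanSpace ℝ (Fin d)) = Module.finrank ℝ E := by
    rw [finrank_euclideanSpace_fin]
  let ψ : EuclideanSpace ℝ (Fin d) ≃L[ℝ] E := ContinuousLinearEquiv.ofFinrankEq hfin
  -- the pulled-back function and domain
  let F : EuclideanSpace ℝ (Fin d) → ℝ := fun y => f (ψ y)
  have hU' : IsOpen (ψ ⁻¹' U) := hU.preimage ψ.continuous
  have hU'c : IsConnected (ψ ⁻¹' U) := by
    rw [← ψ.toHomeomorph.isConnected_preimage] at hUc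
    exact hUc
  have hF : AnalyticOnNhd ℝ F (ψ ⁻¹' U) := by
    intro y hy
    exact (hf (ψ y) hy).comp ((ψ : EuclideanSpace ℝ (Fin d) →L[ℝ] E).analyticAt y)
  have hne' : ∃ y ∈ ψ ⁻¹' U, F y ≠ 0 := by
    obtain ⟨x, hxU, hx⟩ := hne
    refine ⟨ψ.symm x, ?_, ?_⟩
    · show ψ (ψ.symm x) ∈ U
      rw [ContinuousLinearEquiv.apply_symm_apply]; exact hxU
    · show f (ψ (ψ.symm x)) ≠ 0
      rw [ContinuousLinearEquiv.apply_symm_apply]; exact hx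
  -- Mityagin in coordinates
  have hnull : volume {y ∈ ψ ⁻¹' U | F y = 0} = 0 :=
    realAnalytic_zeroSet_null_holds d (ψ ⁻¹' U) F hU' hU'c hF hne'
  have hpre : ψ ⁻¹' {x ∈ U | f x = 0} = {y ∈ ψ ⁻¹' U | F y = 0} := by
    ext y; simp only [Set.mem_preimage, Set.mem_setOf_eq, F]
  -- transport: `η = c • ψ_* vol`
  set ν : Measure E := Measure.map ψ volume with hν
  haveI : ν.IsAddHaarMeasure := ψ.isAddHaarMeasure_map volume
  have hη : η = η.addHaarScalarFactor ν • ν := Measure.isAddLeftInvariant_eq_smul η ν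
  have hνS : ν {x ∈ U | f x = 0} = 0 := by
    have h1 := ψ.toHomeomorph.toMeasurableEquiv.map_apply (μ := volume) {x ∈ U | f x = 0}
    rw [Homeomorph.toMeasurableEquiv_coe, ContinuousLinearEquiv.coe_toHomeomorph] at h1
    rw [hν, h1, hpre]; exact hnull
  rw [hη, Measure.coe_nnreal_smul_apply, hνS, mul_zero]

/-- The whole-space form: `f : E → ℝ` real-analytic everywhere and `f x ≠ 0` for some `x` ⟹ `η {f = 0} = 0`.
[cite: Mityagin2015, Proposition 1] -/
theorem addHaar_zeroSet_eq_zero_of_analyticOnNhd_univ {f : E → ℝ} (hf : AnalyticOnNhd ℝ f Set.univ)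
    (hne : ∃ x, f x ≠ 0) : η {x | f x = 0} = 0 := by
  have h := addHaar_zeroSet_eq_zero_of_analyticOnNhd η isOpen_univ isConnected_univ hf
    (by obtain ⟨x, hx⟩ := hne; exact ⟨x, Set.mem_univ x, hx⟩)
  simpa only [Set.mem_univ, true_and] using h

/-- **`ℂ`-valued form**: if `f : E → ℂ` is real-analytic (`AnalyticOnNhd ℝ`) on the connected open set `U` and
`f x ≠ 0` for some `x ∈ U`, then `η {x ∈ U | f x = 0} = 0` — applied to the real-analytic real function
`|f|² = (Re f)² + (Im f)²`, which has the same zeros. [cite: Mityagin2015, Proposition 1] -/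
theorem addHaar_zeroSet_eq_zero_of_analyticOnNhd_complex {U : Set E} (hU : IsOpen U) (hUc : IsConnected U)
    {f : E → ℂ} (hf : AnalyticOnNhd ℝ f U) (hne : ∃ x ∈ U, f x ≠ 0) : η {x ∈ U | f x = 0} = 0 := by
  let g : E → ℝ := fun x => (f x).re ^ 2 + (f x).im ^ 2
  have hg : AnalyticOnNhd ℝ g U := by
    intro x hx
    have hre : AnalyticAt ℝ (fun y => (f y).re) x := (Complex.reCLM.analyticAt _).comp (hf x hx)
    have him : AnalyticAt ℝ (fun y => (f y).im) x := (Complex.imCLM.analyticAt _).comp (hf x hx)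
    exact (hre.pow 2).add (him.pow 2)
  have hg0 : ∀ x, g x = 0 ↔ f x = 0 := by
    intro x
    change (f x).re ^ 2 + (f x).im ^ 2 = 0 ↔ f x = 0
    constructor
    · intro h
      have hre : (f x).re = 0 := by nlinarith [sq_nonneg (f x).re, sq_nonneg (f x).im]
      have him : (f x).im = 0 := by nlinarith [sq_nonneg (f x).re, sq_nonneg (f x).im]
      exact Complex.ext hre him
    · intro h; simp [h]
  have hne' : ∃ x ∈ U, g x ≠ 0 := by
    obtain ⟨x, hxU, hx⟩ := hne
    exact ⟨x, hxU, fun h => hx ((hg0 x).1 h)⟩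
  have h := addHaar_zeroSet_eq_zero_of_analyticOnNhd η hU hUc hg hne'
  have hset : {x ∈ U | f x = 0} = {x ∈ U | g x = 0} := by
    ext x; simp only [Set.mem_setOf_eq, hg0]
  rw [hset]; exact h

/-- The whole-space `ℂ`-valued form. [cite: Mityagin2015, Proposition 1] -/
theorem addHaar_zeroSet_eq_zero_of_analyticOnNhd_complex_univ {f : E → ℂ} (hf : AnalyticOnNhd ℝ f Set.univ)
    (hne : ∃ x, f x ≠ 0) : η {x | f x = 0} = 0 := by
  have h := addHaar_zeroSet_eq_zero_of_analyticOnNhd_complex η isOpen_univ isConnected_univ hf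
    (by obtain ⟨x, hx⟩ := hne; exact ⟨x, Set.mem_univ x, hx⟩)
  simpa only [Set.mem_univ, true_and] using h

/-- Almost-everywhere form (`ℝ`-valued): `η`-a.e. `f x ≠ 0`. [cite: Mityagin2015, Proposition 1] -/
theorem ae_ne_zero_of_analyticOnNhd_univ {f : E → ℝ} (hf : AnalyticOnNhd ℝ f Set.univ) (hne : ∃ x, f x ≠ 0) :
    ∀ᵐ x ∂η, f x ≠ 0 := by
  rw [ae_iff]
  simpa only [not_not] using addHaar_zeroSet_eq_zero_of_analyticOnNhd_univ η hf hne

/-- Almost-everywhere form (`ℂ`-valued): `η`-a.e. `f x ≠ 0`. [cite: Mityagin2015, Proposition 1] -/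
theorem ae_ne_zero_of_analyticOnNhd_complex_univ {f : E → ℂ} (hf : AnalyticOnNhd ℝ f Set.univ)
    (hne : ∃ x, f x ≠ 0) : ∀ᵐ x ∂η, f x ≠ 0 := by
  rw [ae_iff]
  simpa only [not_not] using addHaar_zeroSet_eq_zero_of_analyticOnNhd_complex_univ η hf hne

end Literature.Analysis.Calculus

end
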